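import Summits.Ventures.YMGap.Census.TwoDimExact
import HarnessLib

/-!
# Venture YMGap, track (b) — the two-dimensional census ROWS as theorems for every `L`, `J`: IV.1, II.1 (i),
# (5.23)/(5.24), and (5.15) with and without the positivity guard

HONEST FRAMING: venture file of the cell `pub-ymgap` (QuantumFields programme), track (b); corollaries of the
closed forms `Z_{(ℤ/L)²} = 1 + Σ_n c_n^{L²}`, `Z⁻_V = 1 + Σ_n (−1)^{n|V|} c_n^{L²}` of `Census/TwoDimExact`.  Two
dimensions only — identities and inequalities between finite sums; NOTHING here bears on `d = 4`, limits,
confinement or a mass gap.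

* `twistLe_two` — IV.1 (arXiv:0707.2179 (4.5)) for EVERY twist set and every `L` (no parity / positivity hypothesis);
* `coeffMonotone_two` — II.1 (i) ((2.12)) for every `L`;
* `torusZ_two_scaleCoeff`, `torusZtw_two_scaleCoeff` — along the interpolation ray `α ↦ α c` both partition
  functions are `1 + α^{L²}·const`;
* **`vortexRatioAntitone_two`** — (5.23)/(5.24): `α ↦ Z⁻_V({αc})/Z({αc})` is non-increasing on `[0,1]` for every
  admissible `c`, every `V`, every `L`, every cut-off `J`; `vortexRatio_two_strictAntiOn` — STRICTLY decreasing when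
  `|V|` is odd and some half-integer spin is on ((5.24) as printed, `d/dα (Z⁻/Z) < 0`);
* `ineq515_two_of_pos` — (5.15) in the form (5.17), `∂_α log Z⁻_V ≤ ∂_α log Z`, at every `α ∈ (0,1)` where
  `Z⁻_V({αc}) > 0`;
* `not_ineq515_two_indicator` — the guard is needed: for the admissible `c = 𝟙_{{1,3}}` and `|V|` odd the TYPED
  `Ineq515` (which carries no guard) fails on every `(ℤ/L)²`, in the regime `Z⁻ < 0` (outside the printed
  hypotheses of arXiv:0707.2179, whose coefficients are Wilson's `c_j(β) = I_{2j+1}(β)/I₁(β)`).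

References: E. T. Tomboulis, arXiv:0707.2179 §§2, 4, 5 [cite: Tomboulis2007Confinement, §4 (4.5), §5 (5.15)–(5.17),
(5.23)–(5.24)]; K. R. Ito, E. Seiler, arXiv:0711.4930 §3 eq. (3.4) [cite: ItoSeiler2007Tomboulis, §3 eq. (3.4)].
-/

noncomputable section

open MeasureTheory Finset Real Function
open scoped BigOperators
open Literature.MathematicalPhysics.QuantumLattice
open Literature.MathematicalPhysics.QuantumFieldTheory
open Literature.MathematicalPhysics.QuantumFieldTheory.Tomboulis2007

namespace Summit.Ventures.YMGap.Census

variable {L : ℕ} [NeZero L]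

/-! ### Corollaries: IV.1, II.1 (i), the interpolation ray, (5.23)/(5.24) and (5.15) in two dimensions -/

/-- **IV.1 in two dimensions, for every twist set and every `L`** (no parity or positivity hypothesis):
`Z⁻_V ≤ Z` termwise. -/
theorem twistLe_two (J : ℕ) (V : Finset (Plaquette 2 L)) : TwistLe 2 L J V := by
  intro c hc
  rw [torusZtw_two, torusZ_two]
  refine add_le_add le_rfl (Finset.sum_le_sum fun n hn => ?_)
  have hcn : 0 ≤ c n ^ (L ^ 2) := pow_nonneg (hc n (Finset.mem_Icc.1 hn).1).1 _
  calc (-1 : ℝ) ^ (n * V.card) * c n ^ (L ^ 2) ≤ 1 * c n ^ (L ^ 2) := by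
        refine mul_le_mul_of_nonneg_right ?_ hcn
        rcases neg_one_pow_eq_or ℝ (n * V.card) with h | h
        · rw [h]
        · rw [h]; norm_num
    _ = c n ^ (L ^ 2) := one_mul _

/-- **II.1 (i) in two dimensions, every `L`**: `Z` is monotone in the coefficients. -/
theorem coeffMonotone_two (J : ℕ) : CoeffMonotone 2 L J := by
  intro c c' hc _ hle
  rw [torusZ_two, torusZ_two]
  refine add_le_add le_rfl (Finset.sum_le_sum fun n hn => ?_)
  exact pow_le_pow_left₀ (hc n (Finset.mem_Icc.1 hn).1).1 (hle n) _

/-- `Z` along the interpolation ray: `Z({α c_j}) = 1 + α^{L²} Σ_{n=1}^{J} c_n^{L²}`. -/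
theorem torusZ_two_scaleCoeff (J : ℕ) (c : ℕ → ℝ) (α : ℝ) :
    torusZ 2 L J (scaleCoeff α c) = 1 + α ^ (L ^ 2) * ∑ n ∈ Icc 1 J, c n ^ (L ^ 2) := by
  rw [torusZ_two, Finset.mul_sum]
  congr 1
  refine Finset.sum_congr rfl fun n _ => ?_
  simp [scaleCoeff, mul_pow]

/-- `Z⁻_V` along the interpolation ray: `Z⁻_V({α c_j}) = 1 + α^{L²} Σ_{n=1}^{J} (−1)^{n|V|} c_n^{L²}`. -/
theorem torusZtw_two_scaleCoeff (J : ℕ) (c : ℕ → ℝ) (V : Finset (Plaquette 2 L)) (α : ℝ) :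
    torusZtw 2 L J (scaleCoeff α c) V =
      1 + α ^ (L ^ 2) * ∑ n ∈ Icc 1 J, (-1 : ℝ) ^ (n * V.card) * c n ^ (L ^ 2) := by
  rw [torusZtw_two, Finset.mul_sum]
  congr 1
  refine Finset.sum_congr rfl fun n _ => ?_
  simp only [scaleCoeff, mul_pow]
  ring

/-- For admissible `c`: `S := Σ_{n=1}^{J} c_n^{L²} ≥ 0`. -/
theorem sum_pow_nonneg_of_admissible {J : ℕ} {c : ℕ → ℝ} (hc : CoeffAdmissible c) (A : ℕ) :
    0 ≤ ∑ n ∈ Icc 1 J, c n ^ A :=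
  Finset.sum_nonneg fun n hn => pow_nonneg (hc n (Finset.mem_Icc.1 hn).1).1 _

/-- For admissible `c` the signed sum is bounded by the unsigned one in absolute value:
`|Σ (−1)^{n k} c_n^A| ≤ Σ c_n^A`. -/
theorem abs_signed_sum_le {J : ℕ} {c : ℕ → ℝ} (hc : CoeffAdmissible c) (A k : ℕ) :
    |∑ n ∈ Icc 1 J, (-1 : ℝ) ^ (n * k) * c n ^ A| ≤ ∑ n ∈ Icc 1 J, c n ^ A := by
  refine (Finset.abs_sum_le_sum_abs _ _).trans (Finset.sum_le_sum fun n hn => ?_)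
  rw [abs_mul, abs_pow, abs_neg, abs_one, one_pow, one_mul,
    abs_of_nonneg (pow_nonneg (hc n (Finset.mem_Icc.1 hn).1).1 _)]

/-- **(5.23)/(5.24) in two dimensions, for every `L`, `J`, admissible `c` and twist set `V`**: the vortex
free-energy ratio `α ↦ Z⁻_V({α c_j})/Z({α c_j})` is non-increasing on `[0, 1]`.  (With `t = α^{L²}`,
`S = Σ c_n^{L²}`, `T = Σ (−1)^{n|V|} c_n^{L²}`: the ratio is `(1 + tT)/(1 + tS)` and `T ≤ S`.) -/
theorem vortexRatioAntitone_two (J : ℕ) {c : ℕ → ℝ} (hc : CoeffAdmissible c) (V : Finset (Plaquette 2 L)) :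
    VortexRatioAntitone 2 L J c V := by
  intro α hα β hβ hαβ
  simp only [vortexRatio, torusZ_two_scaleCoeff, torusZtw_two_scaleCoeff]
  set S := ∑ n ∈ Icc 1 J, c n ^ (L ^ 2) with hS
  set T := ∑ n ∈ Icc 1 J, (-1 : ℝ) ^ (n * V.card) * c n ^ (L ^ 2) with hT
  have hS0 : 0 ≤ S := sum_pow_nonneg_of_admissible hc _
  have hTS : T ≤ S := (le_abs_self T).trans (abs_signed_sum_le hc _ _)
  have ha0 : 0 ≤ α ^ (L ^ 2) := pow_nonneg hα.1 _
  have hb0 : 0 ≤ β ^ (L ^ 2) := pow_nonneg hβ.1 _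
  have hab : α ^ (L ^ 2) ≤ β ^ (L ^ 2) := pow_le_pow_left₀ hα.1 hαβ _
  have hZa : 0 < 1 + α ^ (L ^ 2) * S := by positivity
  have hZb : 0 < 1 + β ^ (L ^ 2) * S := by positivity
  rw [div_le_div_iff₀ hZb hZa]
  nlinarith [mul_nonneg (sub_nonneg.2 hab) (sub_nonneg.2 hTS)]

/-- **(5.24) STRICT in two dimensions**: if the twist set has odd cardinality and some half-integer spin is
switched on (`c_n > 0` for an odd `n ≤ J`), then `α ↦ Z⁻_V({αc})/Z({αc})` is STRICTLY decreasing on `[0,1]`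
(for admissible `c`).  (`T < S` and `α ↦ α^{L²}` strictly increasing.) -/
theorem vortexRatio_two_strictAntiOn (J : ℕ) {c : ℕ → ℝ} (hc : CoeffAdmissible c) (V : Finset (Plaquette 2 L))
    (hV : Odd V.card) (hodd : ∃ n ∈ Icc 1 J, Odd n ∧ 0 < c n) :
    StrictAntiOn (fun α => vortexRatio 2 L J (scaleCoeff α c) V) (Set.Icc (0 : ℝ) 1) := by
  intro α hα β hβ hαβ
  simp only [vortexRatio, torusZ_two_scaleCoeff, torusZtw_two_scaleCoeff]
  set S := ∑ n ∈ Icc 1 J, c n ^ (L ^ 2) with hS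
  set T := ∑ n ∈ Icc 1 J, (-1 : ℝ) ^ (n * V.card) * c n ^ (L ^ 2) with hT
  have hS0 : 0 ≤ S := sum_pow_nonneg_of_admissible hc _
  have hTS : T < S := by
    rw [hT, hS]
    refine Finset.sum_lt_sum (fun n hn => ?_) ?_
    · have hcn : 0 ≤ c n ^ (L ^ 2) := pow_nonneg (hc n (Finset.mem_Icc.1 hn).1).1 _
      calc (-1 : ℝ) ^ (n * V.card) * c n ^ (L ^ 2) ≤ 1 * c n ^ (L ^ 2) := by
            refine mul_le_mul_of_nonneg_right ?_ hcn
            rcases neg_one_pow_eq_or ℝ (n * V.card) with h | h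
            · rw [h]
            · rw [h]; norm_num
        _ = c n ^ (L ^ 2) := one_mul _
    · obtain ⟨n, hn, hno, hcpos⟩ := hodd
      refine ⟨n, hn, ?_⟩
      have hpow : 0 < c n ^ (L ^ 2) := pow_pos hcpos _
      rw [(Nat.odd_mul.2 ⟨hno, hV⟩).neg_one_pow]
      linarith
  have hA : L ^ 2 ≠ 0 := pow_ne_zero _ (NeZero.ne L)
  have hab : α ^ (L ^ 2) < β ^ (L ^ 2) := pow_lt_pow_left₀ hαβ hα.1 hA
  have ha0 : 0 ≤ α ^ (L ^ 2) := pow_nonneg hα.1 _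
  have hZa : 0 < 1 + α ^ (L ^ 2) * S := by positivity
  have hZb : 0 < 1 + β ^ (L ^ 2) * S := by
    have : 0 ≤ β ^ (L ^ 2) := pow_nonneg hβ.1 _
    positivity
  rw [div_lt_div_iff₀ hZb hZa]
  nlinarith [mul_pos (sub_pos.2 hab) (sub_pos.2 hTS)]

/-- **(5.15) ⇔ (5.17) in two dimensions wherever `Z⁻ > 0`**: along the ray, `∂_α log Z⁻_V ≤ ∂_α log Z`
at every `α ∈ (0,1)` at which `Z⁻_V({α c_j}) > 0` (for admissible `c`).  The positivity guard is needed: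
the `Prop` `Ineq515` carries none, and for `c = (1, 0, 1, 0, …)`, `|V|` odd, `Z⁻` changes sign on the ray. -/
theorem ineq515_two_of_pos (J : ℕ) {c : ℕ → ℝ} (hc : CoeffAdmissible c) (V : Finset (Plaquette 2 L))
    (hpos : ∀ α ∈ Set.Ioo (0 : ℝ) 1, 0 < torusZtw 2 L J (scaleCoeff α c) V) :
    Ineq515 2 L J c V := by
  intro α hα
  set S := ∑ n ∈ Icc 1 J, c n ^ (L ^ 2) with hS
  set T := ∑ n ∈ Icc 1 J, (-1 : ℝ) ^ (n * V.card) * c n ^ (L ^ 2) with hT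
  have hS0 : 0 ≤ S := sum_pow_nonneg_of_admissible hc _
  have hTS : T ≤ S := (le_abs_self T).trans (abs_signed_sum_le hc _ _)
  have hZ : ∀ a : ℝ, torusZ 2 L J (scaleCoeff a c) = 1 + a ^ (L ^ 2) * S := fun a =>
    torusZ_two_scaleCoeff J c a
  have hZtw : ∀ a : ℝ, torusZtw 2 L J (scaleCoeff a c) V = 1 + a ^ (L ^ 2) * T := fun a =>
    torusZtw_two_scaleCoeff J c V a
  have hα0 : 0 ≤ α := hα.1.le
  have hZa : 0 < 1 + α ^ (L ^ 2) * S := by positivity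
  have hZta : 0 < 1 + α ^ (L ^ 2) * T := by rw [← hZtw]; exact hpos α hα
  -- derivatives of the two closed forms
  have hdZ : HasDerivAt (fun a : ℝ => 1 + a ^ (L ^ 2) * S) ((L ^ 2 : ℕ) * α ^ (L ^ 2 - 1) * S) α := by
    have h := ((hasDerivAt_pow (L ^ 2) α).mul_const S).const_add 1
    simpa using h
  have hdZtw : HasDerivAt (fun a : ℝ => 1 + a ^ (L ^ 2) * T) ((L ^ 2 : ℕ) * α ^ (L ^ 2 - 1) * T) α := by
    have h := ((hasDerivAt_pow (L ^ 2) α).mul_const T).const_add 1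
    simpa using h
  have hlogZ : HasDerivAt (fun a : ℝ => Real.log (torusZ 2 L J (scaleCoeff a c)))
      (((L ^ 2 : ℕ) * α ^ (L ^ 2 - 1) * S) / (1 + α ^ (L ^ 2) * S)) α := by
    simp_rw [hZ]
    exact hdZ.log hZa.ne'
  have hlogZtw : HasDerivAt (fun a : ℝ => Real.log (torusZtw 2 L J (scaleCoeff a c) V))
      (((L ^ 2 : ℕ) * α ^ (L ^ 2 - 1) * T) / (1 + α ^ (L ^ 2) * T)) α := by
    simp_rw [hZtw]
    exact hdZtw.log hZta.ne'
  rw [hlogZtw.deriv, hlogZ.deriv, div_le_div_iff₀ hZta hZa]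
  have hK : 0 ≤ ((L ^ 2 : ℕ) : ℝ) * α ^ (L ^ 2 - 1) := by positivity
  nlinarith [mul_nonneg hK (sub_nonneg.2 hTS)]

/-- **The positivity guard is necessary.**  For the admissible coefficient vector `c = 𝟙_{{1,3}}`
(`c_{1/2} = c_{3/2} = 1`, every other `c_j = 0`, cut-off `J = 3`) and any twist set `V` of odd cardinality
(e.g. Tomboulis's `𝒱₀₁`), `Z({αc}) = 1 + 2α^{L²}` and `Z⁻_V({αc}) = 1 − 2α^{L²}` on the 2-torus, so `Z⁻_V`
changes sign on the ray and the TYPED inequality `Ineq515` (no guard `Z⁻ > 0`) fails on EVERY `(ℤ/L)²`: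
at `α = 1 − 1/(4L²)` one has `α^{L²} ≥ 3/4` and `∂_α log Z⁻_V = 2K/(2α^{L²} − 1) > 2K/(1 + 2α^{L²}) = ∂_α log Z`,
`K = L² α^{L²−1} > 0`.  (A statement about the typing, in the `Z⁻ < 0` regime — outside every printed
hypothesis of arXiv:0707.2179, whose coefficients are Wilson's.) -/
theorem not_ineq515_two_indicator (V : Finset (Plaquette 2 L)) (hV : Odd V.card) :
    ¬ Ineq515 2 L 3 (fun n => if n = 1 ∨ n = 3 then (1 : ℝ) else 0) V := by
  classical
  set c : ℕ → ℝ := fun n => if n = 1 ∨ n = 3 then (1 : ℝ) else 0 with hc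
  have hA : L ^ 2 ≠ 0 := pow_ne_zero _ (NeZero.ne L)
  have hIcc : Finset.Icc 1 3 = {1, 2, 3} := by decide
  have hS : ∑ n ∈ Icc 1 3, c n ^ (L ^ 2) = 2 := by
    rw [hIcc, Finset.sum_insert (by decide), Finset.sum_insert (by decide), Finset.sum_singleton, hc]
    simp only []
    norm_num [zero_pow hA]
  have h1 : (-1 : ℝ) ^ (1 * V.card) = -1 := by rw [one_mul]; exact hV.neg_one_pow
  have h3 : (-1 : ℝ) ^ (3 * V.card) = -1 := (Nat.odd_mul.2 ⟨by decide, hV⟩).neg_one_pow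
  have hT : ∑ n ∈ Icc 1 3, (-1 : ℝ) ^ (n * V.card) * c n ^ (L ^ 2) = -2 := by
    rw [hIcc, Finset.sum_insert (by decide), Finset.sum_insert (by decide), Finset.sum_singleton, hc, h1, h3]
    simp only []
    norm_num [zero_pow hA]
  have hZ : ∀ a : ℝ, torusZ 2 L 3 (scaleCoeff a c) = 1 + a ^ (L ^ 2) * 2 := fun a => by
    rw [torusZ_two_scaleCoeff, hS]
  have hZtw : ∀ a : ℝ, torusZtw 2 L 3 (scaleCoeff a c) V = 1 + a ^ (L ^ 2) * (-2) := fun a => by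
    rw [torusZtw_two_scaleCoeff, hT]
  -- the point `α = 1 − 1/(4 L²)`
  set α : ℝ := 1 - 1 / (4 * (L ^ 2 : ℕ)) with hα
  have hA1 : (1 : ℝ) ≤ (L ^ 2 : ℕ) := by exact_mod_cast Nat.one_le_iff_ne_zero.2 hA
  have hα0 : 0 < α := by
    rw [hα]
    have : 1 / (4 * ((L ^ 2 : ℕ) : ℝ)) ≤ 1 / 4 := by
      rw [div_le_div_iff₀ (by positivity) (by norm_num)]
      linarith
    linarith
  have hα1 : α < 1 := by
    rw [hα]
    have : 0 < 1 / (4 * ((L ^ 2 : ℕ) : ℝ)) := by positivity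
    linarith
  have hu : (3 : ℝ) / 4 ≤ α ^ (L ^ 2) := by
    have hb := one_add_mul_le_pow (a := -(1 / (4 * ((L ^ 2 : ℕ) : ℝ))))
      (by
        have : 0 < 1 / (4 * ((L ^ 2 : ℕ) : ℝ)) := by positivity
        have : 1 / (4 * ((L ^ 2 : ℕ) : ℝ)) ≤ 1 / 4 := by
          rw [div_le_div_iff₀ (by positivity) (by norm_num)]
          linarith
        linarith) (L ^ 2)
    have hAne : ((L ^ 2 : ℕ) : ℝ) ≠ 0 := by positivity
    have hlhs : (1 : ℝ) + ((L ^ 2 : ℕ) : ℝ) * -(1 / (4 * ((L ^ 2 : ℕ) : ℝ))) = 3 / 4 := by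
      field_simp
      ring
    rw [hlhs] at hb
    rw [hα, sub_eq_add_neg]
    exact hb
  intro h515
  have h := h515 α ⟨hα0, hα1⟩
  have hZa : 0 < 1 + α ^ (L ^ 2) * 2 := by positivity
  have hZta : 1 + α ^ (L ^ 2) * (-2) < 0 := by linarith
  have hdZ : HasDerivAt (fun a : ℝ => 1 + a ^ (L ^ 2) * 2) ((L ^ 2 : ℕ) * α ^ (L ^ 2 - 1) * 2) α := by
    have h := ((hasDerivAt_pow (L ^ 2) α).mul_const (2 : ℝ)).const_add 1
    simpa using h
  have hdZtw : HasDerivAt (fun a : ℝ => 1 + a ^ (L ^ 2) * (-2)) ((L ^ 2 : ℕ) * α ^ (L ^ 2 - 1) * (-2)) α := by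
    have h := ((hasDerivAt_pow (L ^ 2) α).mul_const (-2 : ℝ)).const_add 1
    simpa using h
  have hlogZ : HasDerivAt (fun a : ℝ => Real.log (torusZ 2 L 3 (scaleCoeff a c)))
      (((L ^ 2 : ℕ) * α ^ (L ^ 2 - 1) * 2) / (1 + α ^ (L ^ 2) * 2)) α := by
    simp_rw [hZ]
    exact hdZ.log hZa.ne'
  have hlogZtw : HasDerivAt (fun a : ℝ => Real.log (torusZtw 2 L 3 (scaleCoeff a c) V))
      (((L ^ 2 : ℕ) * α ^ (L ^ 2 - 1) * (-2)) / (1 + α ^ (L ^ 2) * (-2))) α := by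
    simp_rw [hZtw]
    exact hdZtw.log hZta.ne
  rw [hlogZtw.deriv, hlogZ.deriv] at h
  have hK : 0 < ((L ^ 2 : ℕ) : ℝ) * α ^ (L ^ 2 - 1) := by positivity
  -- `2K/(1+2u) < 2K/(2u−1)` with `u = α^{L²} ≥ 3/4`
  have hlt : ((L ^ 2 : ℕ) * α ^ (L ^ 2 - 1) * 2) / (1 + α ^ (L ^ 2) * 2) <
      ((L ^ 2 : ℕ) * α ^ (L ^ 2 - 1) * (-2)) / (1 + α ^ (L ^ 2) * (-2)) := by
    have hrw : ((L ^ 2 : ℕ) * α ^ (L ^ 2 - 1) * (-2)) / (1 + α ^ (L ^ 2) * (-2)) =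
        ((L ^ 2 : ℕ) * α ^ (L ^ 2 - 1) * 2) / (2 * α ^ (L ^ 2) - 1) := by
      rw [← neg_div_neg_eq]
      ring_nf
    rw [hrw]
    exact div_lt_div_of_pos_left (by positivity) (by linarith) (by linarith)
  exact absurd h (not_le.2 hlt)

/-- The coefficient vector `𝟙_{{1,3}}` of `not_ineq515_two_indicator` is admissible in Tomboulis's sense
(`0 ≤ c_j ≤ 1`, arXiv:0707.2179 (2.8)): the counterexample lives inside the typed hypothesis box. -/
theorem coeffAdmissible_indicator13 : CoeffAdmissible (fun n => if n = 1 ∨ n = 3 then (1 : ℝ) else 0) := by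
  intro n _
  by_cases h : n = 1 ∨ n = 3
  · simp only [if_pos h]; norm_num
  · simp only [if_neg h]; norm_num

end Summit.Ventures.YMGap.Census
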